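import Literature.MathematicalPhysics.QuantumFieldTheory.Balaban1983to89.B9Eq3105AtLettersNearH
import Literature.MathematicalPhysics.QuantumFieldTheory.Balaban1983to89.B9Eq3105TAtLettersNearH
import Literature.MathematicalPhysics.QuantumFieldTheory.Balaban1983to89.B9Thm39CinvTorusRegular

/-!
# `Balaban1983to89.B9Eq3105Coords` — T. Bałaban, *Propagators for lattice gauge theories in a background field*, Commun. Math. Phys. **99** (1985) 389–434
# [Balaban1985BackgroundPropagators], (3.105) p. 414 «Δ_aG₀ = I − R» AND ITS TRANSPOSE IN REAL COORDINATES: the two identities of this seat's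
# `B9Eq3105AtLettersNearH` ∕ `B9Eq3105TAtLettersNearH` restricted to real scalars and conjugated by a real basis `b` of `𝔸` — the `eq3105` ∕ `eq3105T` ∕ `inv` ∕
# `invT` fields of the Theorem 3.10 glue `B9Thm310Whole.Identities310` at the cube cover of record (sub-row G-B9-LETTERS, module M5.7 «(3.105) assembly», last file)

statement-level skeleton of published theorems with citation tags; proofs where landed; nothing here is a claim about the Yang–Mills mass gap

PDF held: `paper:balaban1985-cmp99-background-propagators` (journal page = PDF page + 388).  p. 414 (3.105) «Δ_aG₀ = I − Σ_□K(h_□)G_□h_□ − Σ_□(1 − ζ_□̃)DPD*h_□G_□h_□ −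
Σ_□ζ_□̃(DPD* − DP_□D*)h_□G_□h_□ − Σ_□ζ_□̃P_{□,1}(∂h_□)G_□h_□ = I − R»; (3.27) p. 395 «G(U) = Δ_a(U)⁻¹»; (3.87) p. 409 «G₀ = Σ_{□∈𝒟} h_□G_□h_□»; [4] (2.52) p. 232
(the block language of the real-coordinate letters; p. 232 «A summation preserves it also»).

WHAT THIS FILE IS.  The glue `B9Thm310Whole` reads its letters as ℝ-linear maps on the real coordinates `X = FBondY i × ι` of a basis `b` (`B9Eq352DivFormLetters.conj`),
with the cut-offs as `B9Thm37Sum.mulOp`; p21's M5.5 ∕ M5.6 files did the same transfer for (3.88) ∕ (3.95) (`B9Thm37GpTorusRegularFinal.h388_restrict_of_loc`,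
`B9Thm39CinvTorusRegular.conj_cutMulY`).  THIS FILE transfers the bond-sector (3.105) pair: §1 `End_ℂ → End_ℝ` pointwise (`restrictB_mul_eq_one`, ★ `eq3105_restrict`,
★ `eq3105T_restrict` — the identities of the parents read after `restrictScalars ℝ`, the four families of `R` ∕ `R♯` kept as whole ℂ-letters); §2 through `conj b`:
`conj_GAY_mul_deltaAY` ∕ `conj_deltaAY_mul_GAY` (the `inv` ∕ `invT` fields from `IsUnit (Δ_a(U))`, def-Y's `G(U) = Δ_a(U)⁻¹`), ★★ `eq3105_conj` ∕ ★★ `eq3105T_conj` — with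
`conj b (h_□·) = mulOp (h_□ ∘ fst)` (p21's `conj_cutMulY`) the LITERAL shapes `Δ * (Σ_□ mulOp h_□ * Gsq_□ * mulOp h_□) = 1 − (four sums)` and its transpose.
HONEST SCOPE.  Bookkeeping; hypotheses as in the parents (`IsUnit (Δ_{a,□}(U))` for every cube, a choice of `ζ_□̃ = 1 on supp h_□`) plus `IsUnit (Δ_a(U))` for the
`inv` fields; the single-index packaging `Σ_a R_a` of the four families and the choice of the factor index type `A` are the glue instantiation's; nothing continuum ∕ OS ∕
mass gap ∕ Clay; YM mass gap NOT proved by any of this (Track A conditional rung).  `--supports stmt-QuantumFields-19200`.  Net new unproved facts: 0.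
-/

noncomputable section

namespace Literature.MathematicalPhysics.QuantumFieldTheory.Balaban1983to89.B9Eq3105Coords

open Node00
open B9Thm37Sum (mulOp)
open B9Thm37CubeCoverCommutators (cutMulY hTY)
open B9Eq3104CutoffCommutators (hBdY KhBY DPDsY)
open B9CubeLettersBondOpsL0 (deltaACubeY GACubeY)
open B9Eq3105AtLetters (DPDsCubeY P1CubeY)
open B9Eq3105AtLettersNearH (eq3105_hT_GACubeY_of_hT)
open B9Eq3105TAtLettersNearH (eq3105T_hT_GACubeY_of_hT)
open B9Eq352DivFormLetters (conj conj_sub conj_neg)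
open B9Eq352GradLetters (conj_add)
open B9Thm37GpTorusRegular (conj_one conj_sum)
open B9Thm39CinvTorusRegular (conj_cutMulY)
open B6KLevelCensusIndexV1 (KIdx)
open B6Cover236MultiLevelBlocks (cubes)
open scoped Matrix

variable {d ℓ : ℕ} {hd : 1 ≤ d + 1} {hL : Odd (ℓ + 1) ∧ 1 < ℓ + 1} {b₀ b₁ : ℝ}
variable {𝔸 : Type} [NormedRing 𝔸] [NormedAlgebra ℂ 𝔸] [CompleteSpace 𝔸]
variable {ι : Type} [Fintype ι]
variable (i : KIdx d ℓ hd hL b₀ b₁) (b : Module.Basis ι ℝ 𝔸)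

/-! ## §1 `End_ℂ → End_ℝ`: the identities after restricting scalars -/

section Restrict

omit [CompleteSpace 𝔸] in
/-- a product equal to one stays so after restricting scalars (bond carrier). [cite: Balaban1985BackgroundPropagators, (3.27) p.395, bookkeeping] -/
theorem restrictB_mul_eq_one {G Δ : Module.End ℂ (FBondY i → 𝔸)} (h : G * Δ = 1) : G.restrictScalars ℝ * Δ.restrictScalars ℝ = 1 :=
  LinearMap.ext fun Λ => LinearMap.congr_fun h Λ

/-- ★ **(3.105) IN `End_ℝ`**: this seat's `eq3105_hT_GACubeY_of_hT` read after `restrictScalars ℝ` — `Δ_a(U)·(Σ_□ h_□G_□(U)h_□) = 1 − Σ(four families)`, the families as whole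
ℂ-letters restricted. [cite: Balaban1985BackgroundPropagators, (3.105) p.414, (3.87) p.409] -/
theorem eq3105_restrict (parS : SiteParY 𝔸 i) (parB : BondParY 𝔸 i) (Gp : SiteOpY 𝔸 i) (U : CfgY 𝔸 i)
    (ζ : ↥(cubes i.D.toDomains) → SiteY i → ℝ) (hζ : ∀ c z, hTY i c z ≠ 0 → ζ c z = 1)
    (hinv : ∀ c : ↥(cubes i.D.toDomains), IsUnit (deltaACubeY i c parS parB U)) :
    (deltaAY i parS parB Gp U).restrictScalars ℝ *
        (∑ c, (cutMulY (𝔸 := 𝔸) (hBdY i (hTY i c))).restrictScalars ℝ * (GACubeY i c parS parB U).restrictScalars ℝ *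
          (cutMulY (𝔸 := 𝔸) (hBdY i (hTY i c))).restrictScalars ℝ) =
      1 - ∑ c, (KhBY i (hTY i c) parB U * GACubeY i c parS parB U * cutMulY (hBdY i (hTY i c))).restrictScalars ℝ
        - ∑ c, ((1 - cutMulY (hBdY i (ζ c))) * DPDsY i parS Gp U *
            (cutMulY (hBdY i (hTY i c)) * GACubeY i c parS parB U * cutMulY (hBdY i (hTY i c)))).restrictScalars ℝ
        - ∑ c, (cutMulY (hBdY i (ζ c)) * (DPDsY i parS Gp U - DPDsCubeY i c parS U) *
            (cutMulY (hBdY i (hTY i c)) * GACubeY i c parS parB U * cutMulY (hBdY i (hTY i c)))).restrictScalars ℝ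
        - ∑ c, (cutMulY (hBdY i (ζ c)) * P1CubeY i c (hTY i c) parS U * GACubeY i c parS parB U * cutMulY (hBdY i (hTY i c))).restrictScalars ℝ := by
  refine LinearMap.ext fun Λ => ?_
  have h := LinearMap.congr_fun (eq3105_hT_GACubeY_of_hT i parS parB Gp U ζ hζ hinv) Λ
  simp only [Module.End.mul_apply, LinearMap.sum_apply, LinearMap.sub_apply, Module.End.one_apply, LinearMap.restrictScalars_apply] at h ⊢
  exact h

/-- ★ **THE TRANSPOSED (3.105) IN `End_ℝ`**: `(Σ_□ h_□G_□(U)h_□)·Δ_a(U) = 1 + Σ h_□G_□K(h_□) + Σ h_□G_□P_{□,1} − Σ (h_□G_□h_□)ζ(DPD* − DP_□D*) − Σ (h_□G_□h_□)(1 − ζ)DPD*`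
after `restrictScalars ℝ`. [cite: Balaban1985BackgroundPropagators, (3.105) p.414 (transposed), (3.87) p.409] -/
theorem eq3105T_restrict (parS : SiteParY 𝔸 i) (parB : BondParY 𝔸 i) (Gp : SiteOpY 𝔸 i) (U : CfgY 𝔸 i)
    (ζ : ↥(cubes i.D.toDomains) → SiteY i → ℝ) (hζ : ∀ c z, hTY i c z ≠ 0 → ζ c z = 1)
    (hinv : ∀ c : ↥(cubes i.D.toDomains), IsUnit (deltaACubeY i c parS parB U)) :
    (∑ c, (cutMulY (𝔸 := 𝔸) (hBdY i (hTY i c))).restrictScalars ℝ * (GACubeY i c parS parB U).restrictScalars ℝ *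
          (cutMulY (𝔸 := 𝔸) (hBdY i (hTY i c))).restrictScalars ℝ) * (deltaAY i parS parB Gp U).restrictScalars ℝ =
      1 + ∑ c, (cutMulY (hBdY i (hTY i c)) * GACubeY i c parS parB U * KhBY i (hTY i c) parB U).restrictScalars ℝ
        + ∑ c, (cutMulY (hBdY i (hTY i c)) * GACubeY i c parS parB U * P1CubeY i c (hTY i c) parS U).restrictScalars ℝ
        - ∑ c, (cutMulY (hBdY i (hTY i c)) * GACubeY i c parS parB U * cutMulY (hBdY i (hTY i c)) *
            (cutMulY (hBdY i (ζ c)) * (DPDsY i parS Gp U - DPDsCubeY i c parS U))).restrictScalars ℝ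
        - ∑ c, (cutMulY (hBdY i (hTY i c)) * GACubeY i c parS parB U * cutMulY (hBdY i (hTY i c)) *
            ((1 - cutMulY (hBdY i (ζ c))) * DPDsY i parS Gp U)).restrictScalars ℝ := by
  refine LinearMap.ext fun Λ => ?_
  have h := LinearMap.congr_fun (eq3105T_hT_GACubeY_of_hT i parS parB Gp U ζ hζ hinv) Λ
  simp only [Module.End.mul_apply, LinearMap.sum_apply, LinearMap.sub_apply, LinearMap.add_apply, Module.End.one_apply,
    LinearMap.restrictScalars_apply] at h ⊢
  exact h

end Restrict

/-! ## §2 Through the real coordinates of a basis `b`: the `Identities310` shapes -/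

section Conj

/-- **`inv`**: `conj b G(U) · conj b Δ_a(U) = 1` for def-Y's `G(U) = Δ_a(U)⁻¹` wherever `Δ_a(U)` is invertible (Thm 3.3's regime).
[cite: Balaban1985BackgroundPropagators, (3.27) p.395 («G(U) = Δ_a(U)⁻¹»), Thm 3.3 p.399] -/
theorem conj_GAY_mul_deltaAY (parS : SiteParY 𝔸 i) (parB : BondParY 𝔸 i) (Gp : SiteOpY 𝔸 i) (U : CfgY 𝔸 i)
    (hU : IsUnit (deltaAY i parS parB Gp U)) :
    conj b ((GAY i parS parB Gp U).restrictScalars ℝ) * conj b ((deltaAY i parS parB Gp U).restrictScalars ℝ) = 1 := by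
  rw [← B9Eq352DivFormLetters.conj_mul, restrictB_mul_eq_one i (GAY_mul_deltaAY i hU), conj_one]

/-- **`invT`**: `conj b Δ_a(U) · conj b G(U) = 1` likewise. [cite: Balaban1985BackgroundPropagators, (3.27) p.395, Thm 3.3 p.399] -/
theorem conj_deltaAY_mul_GAY (parS : SiteParY 𝔸 i) (parB : BondParY 𝔸 i) (Gp : SiteOpY 𝔸 i) (U : CfgY 𝔸 i)
    (hU : IsUnit (deltaAY i parS parB Gp U)) :
    conj b ((deltaAY i parS parB Gp U).restrictScalars ℝ) * conj b ((GAY i parS parB Gp U).restrictScalars ℝ) = 1 := by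
  rw [← B9Eq352DivFormLetters.conj_mul, restrictB_mul_eq_one i (deltaAY_mul_GAY i hU), conj_one]

/-- ★★ **(3.105) IN REAL COORDINATES, THE `eq3105` SHAPE**: with `h_□` read on the coordinates as `mulOp (h_□ ∘ fst)` (p21's `conj_cutMulY`) and the cube letters as
`conj b G_□(U)`: `conj b Δ_a(U) · Σ_□ mulOp h_□ · conj b G_□(U) · mulOp h_□ = 1 − (Σ_□ conj b R¹_□ + Σ_□ conj b R²_□ + Σ_□ conj b R³_□ + Σ_□ conj b R⁴_□)` with the four printed
families `R¹ = K(h_□)G_□h_□`, `R² = (1 − ζ_□̃)DPD*(h_□G_□h_□)`, `R³ = ζ_□̃(DPD* − DP_□D*)(h_□G_□h_□)`, `R⁴ = ζ_□̃P_{□,1}(∂h_□)G_□h_□`.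
[cite: Balaban1985BackgroundPropagators, (3.105) p.414, (3.87) p.409; Balaban1984PropagatorsII, (2.52) p.232] -/
theorem eq3105_conj (parS : SiteParY 𝔸 i) (parB : BondParY 𝔸 i) (Gp : SiteOpY 𝔸 i) (U : CfgY 𝔸 i)
    (ζ : ↥(cubes i.D.toDomains) → SiteY i → ℝ) (hζ : ∀ c z, hTY i c z ≠ 0 → ζ c z = 1)
    (hinv : ∀ c : ↥(cubes i.D.toDomains), IsUnit (deltaACubeY i c parS parB U)) :
    conj b ((deltaAY i parS parB Gp U).restrictScalars ℝ) *
        (∑ c, mulOp (fun p : FBondY i × ι => hBdY i (hTY i c) p.1) * conj b ((GACubeY i c parS parB U).restrictScalars ℝ) *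
          mulOp (fun p : FBondY i × ι => hBdY i (hTY i c) p.1)) =
      1 - (∑ c, conj b ((KhBY i (hTY i c) parB U * GACubeY i c parS parB U * cutMulY (hBdY i (hTY i c))).restrictScalars ℝ)
        + ∑ c, conj b (((1 - cutMulY (hBdY i (ζ c))) * DPDsY i parS Gp U *
            (cutMulY (hBdY i (hTY i c)) * GACubeY i c parS parB U * cutMulY (hBdY i (hTY i c)))).restrictScalars ℝ)
        + ∑ c, conj b ((cutMulY (hBdY i (ζ c)) * (DPDsY i parS Gp U - DPDsCubeY i c parS U) *
            (cutMulY (hBdY i (hTY i c)) * GACubeY i c parS parB U * cutMulY (hBdY i (hTY i c)))).restrictScalars ℝ)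
        + ∑ c, conj b ((cutMulY (hBdY i (ζ c)) * P1CubeY i c (hTY i c) parS U * GACubeY i c parS parB U *
            cutMulY (hBdY i (hTY i c))).restrictScalars ℝ)) := by
  have h := congrArg (conj b) (eq3105_restrict i parS parB Gp U ζ hζ hinv)
  rw [B9Eq352DivFormLetters.conj_mul, conj_sum] at h
  simp only [B9Eq352DivFormLetters.conj_mul, conj_cutMulY, conj_sub, conj_one, conj_sum] at h
  rw [h]
  abel

/-- ★★ **THE TRANSPOSED (3.105) IN REAL COORDINATES, THE `eq3105T` SHAPE**:
`(Σ_□ mulOp h_□ · conj b G_□(U) · mulOp h_□) · conj b Δ_a(U) = 1 − (−Σ conj b R♯¹ − Σ conj b R♯² + Σ conj b R♯³ + Σ conj b R♯⁴)` with `R♯¹ = h_□G_□K(h_□)`,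
`R♯² = h_□G_□P_{□,1}(∂h_□)`, `R♯³ = (h_□G_□h_□)ζ_□̃(DPD* − DP_□D*)`, `R♯⁴ = (h_□G_□h_□)(1 − ζ_□̃)DPD*`. [cite: Balaban1985BackgroundPropagators, (3.105) p.414 (transposed), (3.87) p.409; Balaban1984PropagatorsII, (2.52) p.232] -/
theorem eq3105T_conj (parS : SiteParY 𝔸 i) (parB : BondParY 𝔸 i) (Gp : SiteOpY 𝔸 i) (U : CfgY 𝔸 i)
    (ζ : ↥(cubes i.D.toDomains) → SiteY i → ℝ) (hζ : ∀ c z, hTY i c z ≠ 0 → ζ c z = 1)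
    (hinv : ∀ c : ↥(cubes i.D.toDomains), IsUnit (deltaACubeY i c parS parB U)) :
    (∑ c, mulOp (fun p : FBondY i × ι => hBdY i (hTY i c) p.1) * conj b ((GACubeY i c parS parB U).restrictScalars ℝ) *
          mulOp (fun p : FBondY i × ι => hBdY i (hTY i c) p.1)) * conj b ((deltaAY i parS parB Gp U).restrictScalars ℝ) =
      1 - (-(∑ c, conj b ((cutMulY (hBdY i (hTY i c)) * GACubeY i c parS parB U * KhBY i (hTY i c) parB U).restrictScalars ℝ))
        - ∑ c, conj b ((cutMulY (hBdY i (hTY i c)) * GACubeY i c parS parB U * P1CubeY i c (hTY i c) parS U).restrictScalars ℝ)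
        + ∑ c, conj b ((cutMulY (hBdY i (hTY i c)) * GACubeY i c parS parB U * cutMulY (hBdY i (hTY i c)) *
            (cutMulY (hBdY i (ζ c)) * (DPDsY i parS Gp U - DPDsCubeY i c parS U))).restrictScalars ℝ)
        + ∑ c, conj b ((cutMulY (hBdY i (hTY i c)) * GACubeY i c parS parB U * cutMulY (hBdY i (hTY i c)) *
            ((1 - cutMulY (hBdY i (ζ c))) * DPDsY i parS Gp U)).restrictScalars ℝ)) := by
  have h := congrArg (conj b) (eq3105T_restrict i parS parB Gp U ζ hζ hinv)
  rw [B9Eq352DivFormLetters.conj_mul, conj_sum] at h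
  simp only [B9Eq352DivFormLetters.conj_mul, conj_cutMulY, conj_sub, conj_add, conj_one, conj_sum] at h
  rw [h]
  abel

end Conj

end Literature.MathematicalPhysics.QuantumFieldTheory.Balaban1983to89.B9Eq3105Coords

end
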